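import Mathlib
import Summits.Ventures.PercRepro.TriangleCapAddEdge
import Summits.Ventures.PercRepro.TriangleCapFourRowThreeCapStrict
import Summits.Ventures.PercRepro.TriangleCapFourRowFourAddable

/-!
# PercRepro — THE CAP ON THE CELL `(k, 4, 4)` AT THE ONE-TRIANGLE GAP: a `K₄⁻`-free graph with `4 (k − 4) − 4`
edges on `k ≥ 12` vertices with a vertex of degree `k − 4` is `4`-bipartite or at least `T = 2k − 14` below the
closed form (p3, gen 46; part 199t, second half)

Part 199p's count leaves `E = 0`, `M ≤ 2`; `M = 2` closes below `T` by the crude bounds; `M = 1` is transferred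
to the cell `(k, 4, 3)` BY ADDING THE EDGE of `exists_addable_pair`: `D ⊔ edge u y` is a `K₄⁻`-free cap graph on
`(k, 4, 3)` (part 199s) at least `2k − 16` below its closed form (part 199k), and `Σ d²` drops by
`2 (P_u + d(y)) + 2 ≥ 2K + 2`: exactly `T` (`four_four_cap_T`). The family `T` on `(k, 4, 4)`
(`tFamilyGen (k − 1) 4 2`) is a cap graph, so this is sharp. Axioms: standard.
-/

namespace PercRepro

namespace TriangleCap

namespace C047

open Finset

variable {V : Type*} [Fintype V] [DecidableEq V]

/-- The transfer arithmetic: the strict cap of `(k, 4, 3)` on `D ⊔ edge u y` with `K ≤ P_u + d(y)` gives `T`. -/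
theorem four_four_cap_T_arith (K m S Pu dy : ℕ) (hK : 8 ≤ K) (hm : m + 4 = 4 * K) (hle : K ≤ Pu + dy)
    (h : S + 2 * (Pu + dy) + 2 + 3 * (K + 4 - 4) + (2 * (K + 4) - 18) + 2 ≤ (m + 1) * (K + 4)) :
    S + 4 * (K + 4 - 5) + (2 * (K + 4) - 14) ≤ m * (K + 4) := by
  obtain ⟨t, rfl⟩ : ∃ t, K = t + 8 := ⟨K - 8, by omega⟩
  have hm' : m = 4 * t + 28 := by omega
  subst hm'
  have e1 : t + 8 + 4 - 4 = t + 8 := by omega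
  have e2 : 2 * (t + 8 + 4) - 18 = 2 * t + 6 := by omega
  have e3 : t + 8 + 4 - 5 = t + 7 := by omega
  have e4 : 2 * (t + 8 + 4) - 14 = 2 * t + 10 := by omega
  rw [e1, e2] at h
  rw [e3, e4]
  nlinarith [h, hle]

/-- The arithmetic of `M = 2` at the gap `T`: `P + 6 = 3K`, `S_N ≤ K + 24 + 5P`, `S_R ≤ (K − 2) P`. -/
theorem four_four_cap_T_arith_two (K P SN SR m : ℕ) (hK : 8 ≤ K) (hm : m + 4 = 4 * K) (hP : P + 6 = 3 * K)
    (hSN : SN ≤ K + 24 + 5 * P) (hSR : SR ≤ (K - 2) * P) :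
    K * K + SN + SR + 4 * (K + 4 - 5) + (2 * (K + 4) - 14) ≤ m * (K + 4) := by
  obtain ⟨t, rfl⟩ : ∃ t, K = t + 8 := ⟨K - 8, by omega⟩
  have hP' : P = 3 * t + 18 := by omega
  have hm' : m = 4 * t + 28 := by omega
  subst hP' hm'
  have e1 : t + 8 + 4 - 5 = t + 7 := by omega
  have e2 : 2 * (t + 8 + 4) - 14 = 2 * t + 10 := by omega
  have e3 : t + 8 - 2 = t + 6 := by omega
  rw [e1, e2]
  rw [e3] at hSR
  nlinarith [hSN, hSR]

/-- **THE CAP ON THE CELL `(k, 4, 4)` AT THE ONE-TRIANGLE GAP, `k ≥ 12`:** a `K₄⁻`-free graph with `4 (k − 4) − 4`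
edges and a vertex `x` of degree `k − 4` is a spanning subgraph of some `K(A, Aᶜ)` with `|A| = 4`, or
`Σ_v d(v)² + 4 (k − 5) + (2k − 14) ≤ m k`. -/
theorem four_four_cap_T (D : SimpleGraph V) [DecidableRel D.Adj] (hK : K4mFree D) (hk : 12 ≤ Fintype.card V)
    (hm : D.edgeFinset.card + 4 = 4 * (Fintype.card V - 4)) (x : V) (hx : deg D x + 4 = Fintype.card V) :
    (∃ A : Finset V, A.card = 4 ∧ BipSub D A) ∨
      ∑ v, deg D v * deg D v + 4 * (Fintype.card V - 5) + (2 * Fintype.card V - 14) ≤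
        D.edgeFinset.card * Fintype.card V := by
  by_cases hnot4 : ∃ A : Finset V, A.card = 4 ∧ BipSub D A
  · exact Or.inl hnot4
  obtain ⟨N, hN⟩ : ∃ N : Finset V, N = univ.filter (fun w => D.Adj x w) := ⟨_, rfl⟩
  have hmemN : ∀ w, w ∈ N ↔ D.Adj x w := fun w => by rw [hN, mem_filter]; simp only [mem_univ, true_and]
  have hxN : x ∉ N := fun h => D.irrefl ((hmemN x).mp h)
  have hdx : deg D x = N.card := by rw [hN]; rfl
  obtain ⟨K, hKdef⟩ : ∃ K, N.card = K := ⟨_, rfl⟩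
  have hcardV : Fintype.card V = K + 4 := by omega
  obtain ⟨m, hmdef⟩ : ∃ m, D.edgeFinset.card = m := ⟨_, rfl⟩
  rw [hmdef, hcardV, Nat.add_sub_cancel] at hm
  -- the non-neighbours `R`, `|R| = 3`
  obtain ⟨R, hR⟩ : ∃ R : Finset V, R = (insert x N)ᶜ := ⟨_, rfl⟩
  have hRcard : R.card = 3 := by
    rw [hR, card_compl, card_insert_of_notMem hxN]
    omega
  have hmemR : ∀ w, w ∈ R ↔ w ≠ x ∧ ¬ D.Adj x w := by
    intro w
    rw [hR, mem_compl, mem_insert, hmemN]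
    tauto
  -- the matching inside `N`
  obtain ⟨M, hM⟩ : ∃ M, adjPairs D N = 2 * M := ⟨_, adjPairs_eq_two_mul D N⟩
  have hTf : ∑ y ∈ N, degIn D N y = 2 * M := by rw [← adjPairs_eq_sum_degIn, hM]
  -- `P = Σ_{u ∈ R} degIn N u`, `E = adjPairs R`
  obtain ⟨P, hPdef⟩ : ∃ P, ∑ u ∈ R, degIn D N u = P := ⟨_, rfl⟩
  obtain ⟨E, hEdef⟩ : ∃ E, adjPairs D R = E := ⟨_, rfl⟩
  -- the degree sum over `{x} ∪ N ∪ R`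
  have hsplit : ∀ F : V → ℕ, ∑ w, F w = F x + ∑ y ∈ N, F y + ∑ u ∈ R, F u := by
    intro F
    rw [← sum_add_sum_compl (insert x N), sum_insert hxN, ← hR]
  have hdegN : ∀ y ∈ N, deg D y = 1 + degIn D N y + degIn D R y := by
    intro y hy
    have := deg_eq_of_mem_nbhd D x y ((hmemN y).mp hy)
    rw [← hN, ← hR] at this
    exact this
  have hsumN : ∑ y ∈ N, deg D y = K + 2 * M + P := by
    rw [sum_congr rfl hdegN, sum_add_distrib, sum_add_distrib, sum_const, smul_eq_mul, mul_one, hKdef, hTf,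
      sum_degIn_comm D N R, hPdef]
  have hdegR : ∀ u ∈ R, deg D u = degIn D N u + degIn D R u := by
    intro u hu
    have := deg_eq_of_not_mem_nbhd D x u ((hmemR u).mp hu).2
    rw [← hN, ← hR] at this
    exact this
  have hsumR : ∑ u ∈ R, deg D u = P + E := by
    rw [sum_congr rfl hdegR, sum_add_distrib, hPdef, ← adjPairs_eq_sum_degIn, hEdef]
  have hdegsum := sum_deg_eq D
  rw [hsplit, hsumN, hsumR, hdx, hKdef, hmdef] at hdegsum
  -- (2) every vertex of `R` has at most `K − M` neighbours in `N` (one end of each matching edge)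
  have hPle : ∀ u ∈ R, degIn D N u + M ≤ K := by
    intro u hu
    have := two_mul_degIn_add_adjPairs_le D hK (x := x) ((hmemR u).mp hu).1
    rw [← hN, hM, hKdef] at this
    omega
  have h2 : P + 3 * M ≤ 3 * K := by
    have hs : ∑ u ∈ R, (degIn D N u + M) ≤ ∑ _u ∈ R, K := sum_le_sum hPle
    rw [sum_add_distrib, sum_const, sum_const, smul_eq_mul, smul_eq_mul, hPdef, hRcard] at hs
    exact hs
  -- (3) `E ≤ 6`
  have hE6 : E ≤ 6 := by
    have := adjPairs_le_card_mul_pred D R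
    rw [hEdef, hRcard] at this
    exact this
  -- (4) an edge inside `R` is impossible
  have hnoedge : 1 ≤ E → (E ≤ 4 ∧ P + M ≤ 2 * K + 1) ∨ P + M ≤ 2 * K := by
    intro hE
    have := four_three_noedge D hK x N R hmemN hmemR hRcard K M hKdef hPle (by rw [hEdef]; exact hE)
    rw [hEdef, hPdef] at this
    exact this
  -- (5) `E = 0`, `M ≤ 1`
  obtain ⟨hE0, hM2⟩ := four_four_cap_count K M P E m hdegsum hm h2 hE6 (by omega) hnoedge
  -- no edge inside `R`
  have hnoR : ∀ u ∈ R, degIn D R u = 0 := by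
    intro u hu
    have hle : degIn D R u ≤ ∑ z ∈ R, degIn D R z := single_le_sum (fun _ _ => Nat.zero_le _) hu
    rw [← adjPairs_eq_sum_degIn, hEdef, hE0] at hle
    exact Nat.le_zero.mp hle
  rcases Nat.eq_zero_or_pos M with hM0 | hMpos
  · -- `M = 0`: no edge inside `N`, none inside `R`: `D ⊆ K(Nᶜ, N)`
    left
    have hnoN : ∀ y ∈ N, ∀ y', D.Adj y y' → y' ∉ N := by
      intro y hy y' hyy' hy'
      have h0 : degIn D N y = 0 := by
        have hle : degIn D N y ≤ ∑ z ∈ N, degIn D N z := single_le_sum (fun _ _ => Nat.zero_le _) hy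
        rw [hTf, hM0, mul_zero] at hle
        exact Nat.le_zero.mp hle
      unfold degIn at h0
      rw [card_eq_zero, filter_eq_empty_iff] at h0
      exact h0 hy' hyy'
    have hnoR' : ∀ u ∈ R, ∀ u', D.Adj u u' → u' ∉ R := by
      intro u hu u' huu' hu'
      have h0 := hnoR u hu
      unfold degIn at h0
      rw [card_eq_zero, filter_eq_empty_iff] at h0
      exact h0 hu' huu'
    refine ⟨Nᶜ, ?_, ?_⟩
    · rw [card_compl, hKdef]
      omega
    · intro p q hpq
      rw [mem_compl, mem_compl, not_not]
      constructor
      · intro hpN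
        by_contra hqN
        by_cases hpx : p = x
        · subst hpx
          exact hqN ((hmemN q).mpr hpq)
        by_cases hqx : q = x
        · subst hqx
          exact hpN ((hmemN p).mpr (D.adj_symm hpq))
        have hpR : p ∈ R := (hmemR p).mpr ⟨hpx, fun h => hpN ((hmemN p).mpr h)⟩
        have hqR : q ∈ R := (hmemR q).mpr ⟨hqx, fun h => hqN ((hmemN q).mpr h)⟩
        exact hnoR' p hpR q hpq hqR
      · intro hqN hpN
        exact hnoN p hpN q hpq hqN
  · -- `M ∈ {1, 2}`
    right
    have hdegRu : ∀ u ∈ R, deg D u = degIn D N u := fun u hu => by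
      rw [hdegR u hu, hnoR u hu, add_zero]
    rw [hE0] at hdegsum
    rcases Nat.lt_or_ge M 2 with hM1 | hM2'
    · -- `M = 1`: add an edge and transfer to the strict cap of `(k, 4, 3)`
      have hM1' : M = 1 := by omega
      subst hM1'
      have hP : P + 5 = 3 * K := by omega
      obtain ⟨u, hu, y, hy, hn, hcommon, hle⟩ := exists_addable_pair D hK x N R hmemN hmemR hRcard K hKdef
        (by omega) hTf (fun u hu => hPle u hu) (by rw [hPdef]; exact hP) hnoR
      have huy : u ≠ y := fun h => ((hmemR u).mp hu).2 (by rw [h]; exact (hmemN y).mp hy)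
      have hux : u ≠ x := ((hmemR u).mp hu).1
      have hyx : y ≠ x := fun h => by
        have := (hmemN y).mp hy
        rw [h] at this
        exact D.irrefl this
      -- the graph with the edge `u y`
      have hK' := k4mFree_sup_edge D hK u y huy hn hcommon
      have h1 := sum_deg_eq (D ⊔ SimpleGraph.edge u y)
      have h2 := sum_deg_eq D
      have h3 := sum_deg_sup_edge D u y huy hn
      rw [hmdef] at h2
      have hdx' : deg (D ⊔ SimpleGraph.edge u y) x + 4 = Fintype.card V := by
        rw [deg_sup_edge_other D u y x hux.symm hyx.symm]
        exact hx
      have hsq' := sum_deg_sq_sup_edge D u y huy hn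
      rcases four_three_cap_strict (D ⊔ SimpleGraph.edge u y) hK' (by omega) (by rw [hcardV]; omega) x hdx'
        with ⟨A, hAcard, hB⟩ | hbound
      · exact absurd ⟨A, hAcard, bipSub_of_le D u y A hB⟩ hnot4
      · rw [hsq', hcardV] at hbound
        have hb' : ∑ v, deg D v * deg D v + 2 * (deg D u + deg D y) + 2 + 3 * (K + 4 - 4) + (2 * (K + 4) - 18) + 2 ≤
            (m + 1) * (K + 4) := by
          convert hbound using 3
          omega
        rw [hdegRu u hu] at hb'
        rw [hmdef, hcardV]
        exact four_four_cap_T_arith K m _ _ _ (by omega) hm hle hb'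
    · -- `M = 2`
      have hM2'' : M = 2 := by omega
      subst hM2''
      have hP : P + 6 = 3 * K := by omega
      have hgle : ∀ y ∈ N, degIn D R y ≤ 3 := fun y _ => by
        have := degIn_le_card D R y
        rw [hRcard] at this
        exact this
      have hSN : ∑ y ∈ N, deg D y * deg D y ≤ K + 24 + 5 * P := by
        have h : ∀ y ∈ N, deg D y * deg D y ≤
            1 + 3 * degIn D N y + 5 * degIn D R y + 2 * (degIn D N y * degIn D R y) := by
          intro y hy
          rw [hdegN y hy]
          apply cap_sq_bound
          · have h1 := degIn_nbhd_le_one D hK (x := x) (u := y) ((hmemN y).mp hy)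
            rw [← hN] at h1
            exact h1
          · exact hgle y hy
        have hfg : 2 * ∑ y ∈ N, degIn D N y * degIn D R y ≤ 12 := by
          have := two_mul_sum_degIn_mul_degIn_le D hK x R (fun u hu => ((hmemR u).mp hu).1)
          rw [← hN, hM, hRcard] at this
          exact this
        calc ∑ y ∈ N, deg D y * deg D y
            ≤ ∑ y ∈ N, (1 + 3 * degIn D N y + 5 * degIn D R y + 2 * (degIn D N y * degIn D R y)) := sum_le_sum h
          _ = N.card + 3 * ∑ y ∈ N, degIn D N y + 5 * ∑ y ∈ N, degIn D R y +
              2 * ∑ y ∈ N, degIn D N y * degIn D R y := by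
            rw [sum_add_distrib, sum_add_distrib, sum_add_distrib, sum_const, smul_eq_mul, mul_one, mul_sum,
              mul_sum, mul_sum]
          _ ≤ K + 24 + 5 * P := by
            rw [hKdef, hTf, sum_degIn_comm D N R, hPdef]
            omega
      have hSR : ∑ u ∈ R, deg D u * deg D u ≤ (K - 2) * P := by
        have h : ∀ u ∈ R, deg D u * deg D u ≤ (K - 2) * degIn D N u := by
          intro u hu
          have hle : degIn D N u ≤ K - 2 := by have := hPle u hu; omega
          rw [hdegRu u hu]
          exact Nat.mul_le_mul_right _ hle
        calc ∑ u ∈ R, deg D u * deg D u ≤ ∑ u ∈ R, (K - 2) * degIn D N u := sum_le_sum h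
          _ = (K - 2) * P := by rw [← mul_sum, hPdef]
      rw [hsplit (fun v => deg D v * deg D v), hdx, hKdef, hmdef, hcardV]
      exact four_four_cap_T_arith_two K P _ _ m (by omega) hm hP hSN hSR

end C047

end TriangleCap

end PercRepro
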